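import Mathlib
import HarnessLib
import Summits.ValiantsHypothesis.ValiantsHypothesis.Theorems.LacunarySymmetroidMatrixDescartesProductPlusOneEulerSharpK

/-!
# ValiantsHypothesis / LacunarySymmetroid — crux `MatrixDescartes` (stmt-ValiantsHypothesis-18050, V1),
# LINE (A) «product_plus_one», floor `OneChangeFloorK3` (both couplings): the CROSSING BUDGET — counting the zeros of the
# Euler polynomial of a product by its riser-dominated zeros

The sectors of record (tame / sharp / mixed / coherent / lower-signed, every K) all run through ✓ `euler_pos_roots_le_general`: if the
total Euler ratio `Φ(x) = Σ_j x f_j′(x)/f_j(x)` takes the level `ν` at most ONCE on every zero-free interval, the Euler polynomial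
`E = X·P′ − ν·P` (`P = ∏ f_j`) has at most `Z₊(P) + (Z₊(P) + 1)` positive zeros.  On the research floor (incoherent one-zero factors at ratio
`> 4`, T1+T5 mixtures, the middle coupling) `Φ` is NOT monotone and up-crossings exist (p7 g15 memo §4, p5 g14 memo: certified 5 and 7 zeros on
one component).  This file is the counting framework for that regime, HYPOTHESIS-FREE:

* ★★ `euler_pos_roots_le_budget` — for EVERY product `P = ∏ f_j ≠ 0` with `Z₊(P) ≤ B` and every level `ν`:
  `Z₊(E) ≤ B + (B + 1) + 2·#U`, `U = {z > 0 : E(z) = 0, P(z) ≠ 0, E′(z)·P(z) ≥ 0}` — the zeros of `E` off `Z(P)` at which `Φ` does NOT cross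
  `ν` strictly downwards («riser-dominated» zeros).  Mechanism: on one component of `(0,∞) ∖ Z(P)` two consecutive zeros of `E` cannot both be
  strict down-crossings of `Φ − ν = E/P` (local sign from `HasDerivAt` + the intermediate value theorem), so a component carries at most
  `1 + 2·#(U ∩ component)` zeros (`card_le_two_mul_card_filter_add_one`); components are counted by the fibre map of ✓ `euler_pos_roots_le_general`.
  With `U = ∅` this is that lemma's conclusion from a POINTWISE sign at the zeros instead of monotonicity on intervals.
* `eulerNumerator_pos_roots_le_budget` — the same in the line's `eulerNumerator d a l₀` shape (every format, every coupling).
* Companion file `…ProductPlusOneCrossingSign.lean`: the SIGN of a crossing is the total letter log-Wronskian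
  (`z·E′(z)·P(z) = Σ_j W(f_j)(z)·∏_{i≠j} f_i(z)²`, `W(g) = g·θ(θg) − (θg)²`), its fewnomial form, and the corollary «negative total log-Wronskian at
  the zeros ⇒ `Z₊(E) ≤ B + (B + 1)`».

USE: a budget proof of the floor = this file + a bound `#U ≤ C·m` (p7 g15's ✓ `…UpCrossing` constrains WHERE points of `U` sit).
HONEST FRAMING: framework / calculus; by itself it bounds nothing beyond `2B + 1 + 2·#U`; NOT `OneChangeFloorK3`, not `stub_classRowK3`, not
`stub_polyLaw`, not `MatrixDescartes`, not Conjecture B; `VP ≠ VNP` is NOT proved.  No definitions, no named facts.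
-/

set_option linter.dupNamespace false

namespace Summit.ValiantsHypothesis.ValiantsHypothesis.Theorems.LacunarySymmetroidMatrixDescartes

namespace ProductPlusOne

open Polynomial Finset
open scoped BigOperators Topology

/-! ### §1 Combinatorics: no two consecutive «down» points -/

/-- If no two CONSECUTIVE elements of a finite set of reals are both «down», the set has at most `2·#(not down) + 1` elements.
[folklore] -/
theorem card_le_two_mul_card_filter_add_one (T : Finset ℝ) (Dn : ℝ → Prop) [DecidablePred Dn]
    (h : ∀ z ∈ T, ∀ z' ∈ T, z < z' → (∀ w ∈ T, ¬ (z < w ∧ w < z')) → Dn z → Dn z' → False) :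
    T.card ≤ 2 * (T.filter (fun z => ¬ Dn z)).card + 1 := by
  classical
  rcases T.eq_empty_or_nonempty with rfl | hne
  · simp
  set M := T.max' hne with hM
  set D := T.filter (fun z => Dn z) with hD
  set N := T.filter (fun z => ¬ Dn z) with hN
  have hsplit : T.card = D.card + N.card := by
    rw [hD, hN]; exact (Finset.card_filter_add_card_filter_not _).symm
  -- the successor of a non-maximal element
  have hsucc : ∀ z ∈ T, z < M → ∃ s ∈ T, z < s ∧ ∀ w ∈ T, z < w → s ≤ w := by
    intro z hz hzM
    have hne' : (T.filter (fun w => z < w)).Nonempty := ⟨M, by rw [mem_filter]; exact ⟨Finset.max'_mem _ _, hzM⟩⟩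
    refine ⟨(T.filter (fun w => z < w)).min' hne', ?_, ?_, fun w hw hzw => ?_⟩
    · exact (mem_filter.mp (Finset.min'_mem _ hne')).1
    · exact (mem_filter.mp (Finset.min'_mem _ hne')).2
    · exact Finset.min'_le _ _ (by rw [mem_filter]; exact ⟨hw, hzw⟩)
  choose! nxt hnxtT hnxt_gt hnxt_le using hsucc
  set D' := D.filter (fun z => z < M) with hD'
  have hD'T : ∀ z ∈ D', z ∈ T ∧ Dn z ∧ z < M := fun z hz => by
    rw [hD', mem_filter, hD, mem_filter] at hz
    exact ⟨hz.1.1, hz.1.2, hz.2⟩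
  have hmaps : Set.MapsTo nxt D' N := by
    intro z hz
    obtain ⟨hzT, hzD, hzM⟩ := hD'T z hz
    have hsT := hnxtT z hzT hzM
    rw [Finset.mem_coe, hN, mem_filter]
    refine ⟨hsT, fun hDn => h z hzT (nxt z) hsT (hnxt_gt z hzT hzM) (fun w hw hzw => ?_) hzD hDn⟩
    exact absurd hzw.2 (not_lt.mpr (hnxt_le z hzT hzM w hw hzw.1))
  have hinj : Set.InjOn nxt D' := by
    intro z₁ hz₁ z₂ hz₂ heq
    obtain ⟨h1T, _, h1M⟩ := hD'T z₁ hz₁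
    obtain ⟨h2T, _, h2M⟩ := hD'T z₂ hz₂
    by_contra hne12
    rcases lt_or_gt_of_ne hne12 with h12 | h21
    · have hle : nxt z₁ ≤ z₂ := hnxt_le z₁ h1T h1M z₂ h2T h12
      have hlt : z₂ < nxt z₂ := hnxt_gt z₂ h2T h2M
      exact absurd heq (by linarith : nxt z₁ < nxt z₂).ne
    · have hle : nxt z₂ ≤ z₁ := hnxt_le z₂ h2T h2M z₁ h1T h21
      have hlt : z₁ < nxt z₁ := hnxt_gt z₁ h1T h1M
      exact absurd heq (by linarith : nxt z₂ < nxt z₁).ne'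
  have hD'le : D'.card ≤ N.card := Finset.card_le_card_of_injOn nxt hmaps hinj
  have hDle : D.card ≤ D'.card + 1 := by
    have hsub : D ⊆ insert M D' := by
      intro z hz
      rw [mem_insert]
      have hzT : z ∈ T := (mem_filter.mp hz).1
      rcases eq_or_lt_of_le (Finset.le_max' T z hzT) with hzM | hzM
      · exact Or.inl hzM
      · exact Or.inr (by rw [hD', mem_filter]; exact ⟨hz, hzM⟩)
    exact (card_le_card hsub).trans (Finset.card_insert_le _ _)
  omega

/-! ### §2 Local sign at a strict down-crossing -/

/-- A function vanishing at `z` with a NEGATIVE derivative there is positive just left of `z` and negative just right of it.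
[folklore] -/
theorem exists_sign_nhds_of_hasDerivAt_neg {g : ℝ → ℝ} {g' z : ℝ} (hg : HasDerivAt g g' z) (hz : g z = 0) (hg' : g' < 0) :
    ∃ δ > 0, (∀ y, z - δ < y → y < z → 0 < g y) ∧ (∀ y, z < y → y < z + δ → g y < 0) := by
  have ht : Filter.Tendsto (slope g z) (𝓝[≠] z) (𝓝 g') := hasDerivAt_iff_tendsto_slope.mp hg
  have hev : ∀ᶠ y in 𝓝[≠] z, slope g z y < 0 := ht.eventually (eventually_lt_nhds hg')
  rw [eventually_nhdsWithin_iff, Metric.eventually_nhds_iff] at hev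
  obtain ⟨δ, hδ, hball⟩ := hev
  refine ⟨δ, hδ, fun y h1 h2 => ?_, fun y h1 h2 => ?_⟩
  · have hd : dist y z < δ := by rw [Real.dist_eq, abs_sub_lt_iff]; constructor <;> linarith
    have hs := hball hd (by rw [Set.mem_compl_singleton_iff]; exact h2.ne)
    rw [slope_def_field, hz, sub_zero] at hs
    have hyz : y - z < 0 := by linarith
    rcases div_neg_iff.mp hs with ⟨hpos, _⟩ | ⟨_, hpos'⟩
    · exact hpos
    · exact absurd hpos' (not_lt.mpr hyz.le)
  · have hd : dist y z < δ := by rw [Real.dist_eq, abs_sub_lt_iff]; constructor <;> linarith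
    have hs := hball hd (by rw [Set.mem_compl_singleton_iff]; exact h1.ne')
    rw [slope_def_field, hz, sub_zero] at hs
    have hyz : 0 < y - z := by linarith
    rcases div_neg_iff.mp hs with ⟨_, hneg⟩ | ⟨hneg', _⟩
    · exact absurd hneg (not_lt.mpr hyz.le)
    · exact hneg'

/-! ### §3 The crossing budget -/

/-- ★★ **THE CROSSING BUDGET** (every product, every level): `P = ∏ f_j ≠ 0`, `Z₊(P) ≤ B`, `E = X·P′ − C ν·P` ⇒
`Z₊(E) ≤ B + (B + 1) + 2·#{z > 0 : E(z) = 0, P(z) ≠ 0, E′(z)·P(z) ≥ 0}`. [this file's theorem] -/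
theorem euler_pos_roots_le_budget {m : ℕ} (f : Fin m → ℝ[X]) (hP0 : (∏ j, f j) ≠ 0) (ν : ℝ) (B : ℕ)
    (hZ : ((∏ j, f j).roots.toFinset.filter (fun t => 0 < t)).card ≤ B) :
    ((X * derivative (∏ j, f j) - C ν * ∏ j, f j).roots.toFinset.filter (fun t => 0 < t)).card
      ≤ B + (B + 1) + 2 * (((X * derivative (∏ j, f j) - C ν * ∏ j, f j).roots.toFinset.filter
          (fun z => 0 < z ∧ (∏ j, f j).eval z ≠ 0 ∧
            0 ≤ (derivative (X * derivative (∏ j, f j) - C ν * ∏ j, f j)).eval z * (∏ j, f j).eval z)).card) := by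
  classical
  set P : ℝ[X] := ∏ j, f j with hPdef
  set E : ℝ[X] := X * derivative P - C ν * P with hEdef
  set Zp := P.roots.toFinset.filter (fun t => 0 < t) with hZp
  set S := E.roots.toFinset.filter (fun t => 0 < t) with hSdef
  set U := E.roots.toFinset.filter (fun z => 0 < z ∧ P.eval z ≠ 0 ∧ 0 ≤ (derivative E).eval z * P.eval z) with hUdef
  by_cases hE0 : E = 0
  · have : S = ∅ := by rw [hSdef, hE0, roots_zero, Multiset.toFinset_zero, Finset.filter_empty]
    rw [this, Finset.card_empty]; exact Nat.zero_le _
  have hSmem : ∀ z ∈ S, 0 < z ∧ eval z E = 0 := by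
    intro z hz
    rw [hSdef, mem_filter, Multiset.mem_toFinset, mem_roots hE0] at hz
    exact ⟨hz.2, hz.1⟩
  have hmemS : ∀ z : ℝ, 0 < z → eval z E = 0 → z ∈ S := by
    intro z hz hEz
    rw [hSdef, mem_filter, Multiset.mem_toFinset, mem_roots hE0]
    exact ⟨hEz, hz⟩
  set S₁ := S.filter (fun z => eval z P = 0) with hS₁
  set S₂ := S.filter (fun z => eval z P ≠ 0) with hS₂
  have hsplit : S.card = S₁.card + S₂.card := by
    rw [hS₁, hS₂]; exact (Finset.card_filter_add_card_filter_not _).symm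
  have hS₁le : S₁.card ≤ B := by
    refine le_trans (card_le_card fun z hz => ?_) hZ
    rw [hS₁, mem_filter] at hz
    rw [mem_filter, Multiset.mem_toFinset, mem_roots hP0]
    exact ⟨hz.2, (hSmem z hz.1).1⟩
  -- the «down» predicate and the key fact: no two consecutive down zeros in one component
  let Dn : ℝ → Prop := fun z => (derivative E).eval z * P.eval z < 0
  -- components are labelled by the number of zeros of `P` to the left
  let lab : ℝ → ℕ := fun z => (Zp.filter (fun t => t < z)).card
  have hfree : ∀ z₁ ∈ S₂, ∀ z₃ ∈ S₂, z₁ < z₃ → lab z₁ = lab z₃ → ∀ t ∈ Set.Icc z₁ z₃, P.eval t ≠ 0 := by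
    intro z₁ hz₁ z₃ hz₃ h13 hk13 t ht hPt
    have hz₁0 : 0 < z₁ := by
      have h := hz₁; rw [hS₂, mem_filter] at h; exact (hSmem z₁ h.1).1
    have ht0 : 0 < t := hz₁0.trans_le ht.1
    rcases eq_or_lt_of_le ht.2 with h | h
    · rw [hS₂, mem_filter] at hz₃; exact hz₃.2 (h ▸ hPt)
    · have htZ : t ∈ Zp := by
        rw [hZp, mem_filter, Multiset.mem_toFinset, mem_roots hP0]
        exact ⟨hPt, ht0⟩
      have hsub : Zp.filter (fun s => s < z₁) ⊆ Zp.filter (fun s => s < z₃) := by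
        intro s hs
        rw [mem_filter] at hs ⊢
        exact ⟨hs.1, hs.2.trans h13⟩
      have hstrict : Zp.filter (fun s => s < z₁) ⊂ Zp.filter (fun s => s < z₃) := by
        refine Finset.ssubset_iff_subset_ne.mpr ⟨hsub, fun heq => ?_⟩
        have ht1 : t ∈ Zp.filter (fun s => s < z₁) := by
          rw [heq, mem_filter]
          exact ⟨htZ, h⟩
        rw [mem_filter] at ht1
        exact absurd ht1.2 (not_lt.mpr ht.1)
      exact absurd hk13 (Finset.card_lt_card hstrict).ne
  have hlab_mono : ∀ z₁ z₂ : ℝ, z₁ ≤ z₂ → lab z₁ ≤ lab z₂ := by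
    intro z₁ z₂ h12
    exact card_le_card fun s hs => by
      rw [mem_filter] at hs ⊢
      exact ⟨hs.1, hs.2.trans_le h12⟩
  -- per-fibre bound
  have hfiber : ∀ v ∈ S₂.image lab,
      (S₂.filter (fun z => lab z = v)).card ≤ 2 * ((S₂.filter (fun z => lab z = v)).filter (fun z => ¬ Dn z)).card + 1 := by
    intro v _
    refine card_le_two_mul_card_filter_add_one _ Dn ?_
    intro z hz z' hz' hzz' hcons hDz hDz'
    rw [mem_filter] at hz hz'
    obtain ⟨hzS₂, hzv⟩ := hz
    obtain ⟨hz'S₂, hz'v⟩ := hz'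
    have hz0 : 0 < z := by
      have hh := hzS₂; rw [hS₂, mem_filter] at hh; exact (hSmem z hh.1).1
    have hPz : P.eval z ≠ 0 := by have hh := hzS₂; rw [hS₂, mem_filter] at hh; exact hh.2
    have hPz' : P.eval z' ≠ 0 := by have hh := hz'S₂; rw [hS₂, mem_filter] at hh; exact hh.2
    have hEz : E.eval z = 0 := by have hh := hzS₂; rw [hS₂, mem_filter] at hh; exact (hSmem z hh.1).2
    have hEz' : E.eval z' = 0 := by have hh := hz'S₂; rw [hS₂, mem_filter] at hh; exact (hSmem z' hh.1).2
    have hPI : ∀ t ∈ Set.Icc z z', P.eval t ≠ 0 := hfree z hzS₂ z' hz'S₂ hzz' (hzv.trans hz'v.symm)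
    -- the quotient `g = E/P` and its derivative at the two zeros
    let g : ℝ → ℝ := fun y => E.eval y / P.eval y
    have hderiv : ∀ w, P.eval w ≠ 0 → E.eval w = 0 →
        HasDerivAt g ((derivative E).eval w * P.eval w / (P.eval w) ^ 2) w := by
      intro w hPw hEw
      have h1 := (Polynomial.hasDerivAt E w).div (Polynomial.hasDerivAt P w) hPw
      have : ((derivative E).eval w * P.eval w - E.eval w * (derivative P).eval w) / (P.eval w) ^ 2
          = (derivative E).eval w * P.eval w / (P.eval w) ^ 2 := by rw [hEw, zero_mul, sub_zero]
      rw [this] at h1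
      exact h1
    have hgz : g z = 0 := by show E.eval z / P.eval z = 0; rw [hEz, zero_div]
    have hgz' : g z' = 0 := by show E.eval z' / P.eval z' = 0; rw [hEz', zero_div]
    have hneg : (derivative E).eval z * P.eval z / (P.eval z) ^ 2 < 0 :=
      div_neg_of_neg_of_pos hDz (sq_pos_iff.mpr hPz)
    have hneg' : (derivative E).eval z' * P.eval z' / (P.eval z') ^ 2 < 0 :=
      div_neg_of_neg_of_pos hDz' (sq_pos_iff.mpr hPz')
    obtain ⟨δ, hδ, _, hright⟩ := exists_sign_nhds_of_hasDerivAt_neg (hderiv z hPz hEz) hgz hneg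
    obtain ⟨δ', hδ', hleft', _⟩ := exists_sign_nhds_of_hasDerivAt_neg (hderiv z' hPz' hEz') hgz' hneg'
    -- two interior points with opposite signs
    set a₁ := z + min (δ / 2) ((z' - z) / 3) with ha₁
    set b₁ := z' - min (δ' / 2) ((z' - z) / 3) with hb₁
    have hmin1 : 0 < min (δ / 2) ((z' - z) / 3) := lt_min (by linarith) (by linarith)
    have hmin2 : 0 < min (δ' / 2) ((z' - z) / 3) := lt_min (by linarith) (by linarith)
    have hmin1' : min (δ / 2) ((z' - z) / 3) ≤ (z' - z) / 3 := min_le_right _ _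
    have hmin2' : min (δ' / 2) ((z' - z) / 3) ≤ (z' - z) / 3 := min_le_right _ _
    have hmin1'' : min (δ / 2) ((z' - z) / 3) ≤ δ / 2 := min_le_left _ _
    have hmin2'' : min (δ' / 2) ((z' - z) / 3) ≤ δ' / 2 := min_le_left _ _
    have ha₁z : z < a₁ := by rw [ha₁]; linarith
    have hb₁z' : b₁ < z' := by rw [hb₁]; linarith
    have hab : a₁ < b₁ := by rw [ha₁, hb₁]; linarith
    have hga : g a₁ < 0 := hright a₁ ha₁z (by rw [ha₁]; linarith)
    have hgb : 0 < g b₁ := hleft' b₁ (by rw [hb₁]; linarith) hb₁z'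
    -- `g` is continuous on `[a₁, b₁]` (no zero of `P` there)
    have hcont : ContinuousOn g (Set.Icc a₁ b₁) := by
      refine ContinuousOn.div (Polynomial.continuous E).continuousOn (Polynomial.continuous P).continuousOn ?_
      intro t ht
      exact hPI t ⟨ha₁z.le.trans ht.1, ht.2.trans hb₁z'.le⟩
    obtain ⟨w, hw, hgw⟩ : ∃ w ∈ Set.Ioo a₁ b₁, g w = 0 := by
      have := intermediate_value_Ioo hab.le hcont
      exact this ⟨hga, hgb⟩
    have hwz : z < w := ha₁z.trans hw.1
    have hwz' : w < z' := hw.2.trans hb₁z'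
    have hPw : P.eval w ≠ 0 := hPI w ⟨hwz.le, hwz'.le⟩
    have hEw : E.eval w = 0 := by
      have := hgw
      change E.eval w / P.eval w = 0 at this
      rcases div_eq_zero_iff.mp this with h | h
      · exact h
      · exact absurd h hPw
    have hw0 : 0 < w := hz0.trans hwz
    have hwS₂ : w ∈ S₂ := by
      rw [hS₂, mem_filter]
      exact ⟨hmemS w hw0 hEw, hPw⟩
    -- `w` has the same label: no zero of `P` between `z` and `w`
    have hlabw : lab w = v := by
      refine le_antisymm ?_ (hzv ▸ hlab_mono z w hwz.le)
      rw [← hz'v]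
      exact hlab_mono w z' hwz'.le
    exact hcons w (by rw [mem_filter]; exact ⟨hwS₂, hlabw⟩) ⟨hwz, hwz'⟩
  have himg : S₂.image lab ⊆ Finset.range (B + 1) := by
    intro v hv
    rw [Finset.mem_image] at hv
    obtain ⟨z, _, rfl⟩ := hv
    rw [Finset.mem_range]
    exact Nat.lt_succ_of_le ((Finset.card_filter_le _ _).trans hZ)
  -- the non-down zeros off `Z(P)` are exactly `U`
  have hUeq : ∀ v, ((S₂.filter (fun z => lab z = v)).filter (fun z => ¬ Dn z))
      = U.filter (fun z => lab z = v) := by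
    intro v
    ext z
    simp only [mem_filter, hS₂, hUdef, hSdef, not_lt, Dn]
    constructor
    · rintro ⟨⟨⟨⟨hzr, hz0⟩, hPz⟩, hlv⟩, hnd⟩
      exact ⟨⟨hzr, hz0, hPz, hnd⟩, hlv⟩
    · rintro ⟨⟨hzr, hz0, hPz, hnd⟩, hlv⟩
      exact ⟨⟨⟨⟨hzr, hz0⟩, hPz⟩, hlv⟩, hnd⟩
  have hS₂le : S₂.card ≤ (B + 1) + 2 * U.card :=
    calc S₂.card = ∑ v ∈ S₂.image lab, (S₂.filter (fun z => lab z = v)).card := Finset.card_eq_sum_card_image _ S₂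
      _ ≤ ∑ v ∈ S₂.image lab, (2 * (U.filter (fun z => lab z = v)).card + 1) := by
          refine Finset.sum_le_sum fun v hv => ?_
          have := hfiber v hv
          rw [hUeq v] at this
          exact this
      _ = 2 * (∑ v ∈ S₂.image lab, (U.filter (fun z => lab z = v)).card) + (S₂.image lab).card := by
          rw [Finset.sum_add_distrib, Finset.mul_sum, Finset.sum_const, smul_eq_mul, mul_one]
      _ ≤ 2 * U.card + (B + 1) := by
          refine Nat.add_le_add (Nat.mul_le_mul_left _ ?_) ((Finset.card_le_card himg).trans (by rw [Finset.card_range]))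
          calc ∑ v ∈ S₂.image lab, (U.filter (fun z => lab z = v)).card
              ≤ ∑ v ∈ U.image lab ∪ S₂.image lab, (U.filter (fun z => lab z = v)).card :=
                Finset.sum_le_sum_of_subset (Finset.subset_union_right)
            _ = ∑ v ∈ U.image lab, (U.filter (fun z => lab z = v)).card := by
                refine (Finset.sum_subset (Finset.subset_union_left) fun v _ hv => ?_).symm
                rw [Finset.card_eq_zero, Finset.filter_eq_empty_iff]
                intro z hz hzv
                exact hv (Finset.mem_image.mpr ⟨z, hz, hzv⟩)
            _ = U.card := (Finset.card_eq_sum_card_image _ U).symm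
      _ = (B + 1) + 2 * U.card := by ring
  rw [hsplit]
  calc S₁.card + S₂.card ≤ B + ((B + 1) + 2 * U.card) := Nat.add_le_add hS₁le hS₂le
    _ = B + (B + 1) + 2 * U.card := by ring

/-- **The crossing budget in the line's Euler-numerator shape** (every format `(m, K)`, every support `d`, coefficient table `a`,
coupling `l₀`; `eulerNumerator d a l₀` and the factors `Σ_l C (a j l) X^{d l}` unfolded verbatim, ✓ `eulerNumerator_eq_general`):
`Z₊(R) ≤ B + (B + 1) + 2·#{z > 0 : R(z) = 0, F(z) ≠ 0, R′(z)·F(z) ≥ 0}`. [this file's theorem] -/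
theorem eulerNumerator_pos_roots_le_budget {m K : ℕ} (d : Fin K → ℕ) (a : Fin m → Fin K → ℝ) (l₀ : Fin K)
    (hP0 : (∏ j, ∑ l, C (a j l) * X ^ (d l) : ℝ[X]) ≠ 0) (B : ℕ)
    (hZ : ((∏ j, ∑ l, C (a j l) * X ^ (d l) : ℝ[X]).roots.toFinset.filter (fun t => 0 < t)).card ≤ B) :
    ((∑ j, (∑ l, C (a j l * ((d l : ℝ) - d l₀)) * X ^ (d l)) * ∏ i ∈ Finset.univ.erase j, (∑ l, C (a i l) * X ^ (d l))
        : ℝ[X]).roots.toFinset.filter (fun t => 0 < t)).card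
      ≤ B + (B + 1) + 2 * (((∑ j, (∑ l, C (a j l * ((d l : ℝ) - d l₀)) * X ^ (d l)) * ∏ i ∈ Finset.univ.erase j,
            (∑ l, C (a i l) * X ^ (d l)) : ℝ[X]).roots.toFinset.filter
          (fun z => 0 < z ∧ (∏ j, ∑ l, C (a j l) * X ^ (d l) : ℝ[X]).eval z ≠ 0 ∧
            0 ≤ (derivative (∑ j, (∑ l, C (a j l * ((d l : ℝ) - d l₀)) * X ^ (d l)) * ∏ i ∈ Finset.univ.erase j,
              (∑ l, C (a i l) * X ^ (d l)) : ℝ[X])).eval z * (∏ j, ∑ l, C (a j l) * X ^ (d l) : ℝ[X]).eval z)).card) := by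
  rw [eulerNumerator_eq_general]
  exact euler_pos_roots_le_budget (fun j => ∑ l, C (a j l) * X ^ (d l)) hP0 _ B hZ

end ProductPlusOne

end Summit.ValiantsHypothesis.ValiantsHypothesis.Theorems.LacunarySymmetroidMatrixDescartes
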